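import Summits.Ventures.CertifiedManyBodySolver.Downfold.EmeryFermiSurfaceShape
import HarnessLib

/-!
# Box rule for the Fermi-surface `t′/t` of the σ three-band model (companion of
# `EmeryFermiSurfaceShape`)

Venture CertifiedManyBodySolver, cell `pub/hubbard-downfold` (stage S1), seat hubbard-downfold-mod-4;
namespace `Summit.Ventures.CertifiedManyBodySolver.Downfold.Emery`. Everything here is PROVED (elementary
real inequalities). WHAT THIS IS NOT: a statement about any material; the Fermi-energy bracket
`[ε₁, ε₂]` is an INPUT (the filling ↦ ε_F map is not closed-form and is supplied by the consumer).

`EmeryFermiSurfaceShape` proves that every constant-energy contour of the σ three-band model is exactly a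
`t–t′` one-band contour with `t′/t = fsRatio(ε) = −fsN/(fsD + 2fsN)`, `fsD = (Δ + ε)(t_pd² − t_pp′ε)`,
`fsN = 2t_pd²(t_pp′ + t_pp) + ε(t_pp² − t_pp′²)`. Here:

* `neg_div_add_mono_d` / `neg_div_add_anti_n` — `R(d, n) = −n/(d + 2n)` is increasing in `d` and
  decreasing in `n` on `d, n > 0`;
* `fsRatio_mem_Icc` — THE BOX RULE: `fsD ∈ [d₁, d₂]`, `fsN ∈ [n₁, n₂]` (`0 < d₁`, `0 < n₁`) ⇒
  `t′/t ∈ [−n₂/(d₁ + 2n₂), −n₁/(d₂ + 2n₁)]`;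
* `fsD_mem_Icc`, `fsN_mem_Icc` — corner enclosures of the two weights over a parameter box
  `Δ ∈ [Δ₁, Δ₂]`, `t_pd ∈ [a₁, a₂]`, `t_pp ∈ [b₁, b₂]`, `t_pp′ ∈ [c₁, c₂]`, `ε ∈ [ε₁, ε₂]` (non-negative
  lower corners, `t_pp′·ε ≤ t_pd²` on the box): `fsD` is monotone in `Δ`, `t_pd`, antitone in `t_pp′ε`;
  `fsN = (t_pp′ + t_pp)(2t_pd² + ε(t_pp − t_pp′))` is monotone in `t_pp`, `t_pd` and affine in `ε`.

Together: a three-band parameter BOX and a Fermi-energy bracket give a certified interval for the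
object-E (near-Fermi-surface `t–t′` refit) coordinate `t′/t` of the cell's `router/BOX-SCHEMA.md`.

§2 (appended 2026-08-27): the SCALE. `dcharCubic = ∂_ε charCubic` (exact Taylor identity
`charCubic_taylor`), which on a contour is AFFINE in `x + y` (`dcharCubic_on_contour`) — so the first-order
hopping scale `scaleT = fsT/∂_ε charCubic` of the near-contour `t–t′` model varies monotonically along the
Fermi surface and is bracketed by its values at two reference Fermi points (`dcharCubic_mem_uIcc_on_contour`).
Sources: [AndersenEtAl1995, §6]; [HybertsenSchluterChristensen1989, Eq. (1)].
-/

noncomputable section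

namespace Summit.Ventures.CertifiedManyBodySolver.Downfold.Emery

open Real

/-! ## The box rule for the object-E coordinate `t′/t` -/

/-- `fsRatio` as a function of the two weights: `R(d, n) = −n/(d + 2n)`. [folklore] -/
theorem fsRatio_eq (Δ tpd tpp c ε : ℝ) :
    fsRatio Δ tpd tpp c ε = -fsN tpd tpp c ε / (fsD Δ tpd c ε + 2 * fsN tpd tpp c ε) := rfl

/-- `R(d, n) = −n/(d + 2n)` is increasing in `d` for `n > 0`, `d > 0`. [folklore] -/
theorem neg_div_add_mono_d {d₁ d₂ n : ℝ} (hd₁ : 0 < d₁) (h : d₁ ≤ d₂) (hn : 0 < n) :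
    -n / (d₁ + 2 * n) ≤ -n / (d₂ + 2 * n) := by
  rw [neg_div, neg_div, neg_le_neg_iff]
  exact div_le_div_of_nonneg_left hn.le (by linarith) (by linarith)

/-- `R(d, n) = −n/(d + 2n)` is decreasing in `n` for `d > 0`, `n > 0`. [folklore] -/
theorem neg_div_add_anti_n {d n₁ n₂ : ℝ} (hd : 0 < d) (hn₁ : 0 < n₁) (h : n₁ ≤ n₂) :
    -n₂ / (d + 2 * n₂) ≤ -n₁ / (d + 2 * n₁) := by
  rw [neg_div, neg_div, neg_le_neg_iff, div_le_div_iff₀ (by linarith) (by linarith)]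
  nlinarith

/-- THE BOX RULE for the Fermi-surface `t′/t`: `fsD ∈ [d₁, d₂]`, `fsN ∈ [n₁, n₂]` with `0 < d₁`,
`0 < n₁` ⇒ `fsRatio ∈ [−n₂/(d₁ + 2n₂), −n₁/(d₂ + 2n₁)]`. [folklore] -/
theorem fsRatio_mem_Icc {Δ tpd tpp c ε d₁ d₂ n₁ n₂ : ℝ} (hd₁ : 0 < d₁) (hn₁ : 0 < n₁)
    (hd : fsD Δ tpd c ε ∈ Set.Icc d₁ d₂) (hn : fsN tpd tpp c ε ∈ Set.Icc n₁ n₂) :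
    fsRatio Δ tpd tpp c ε ∈ Set.Icc (-n₂ / (d₁ + 2 * n₂)) (-n₁ / (d₂ + 2 * n₁)) := by
  obtain ⟨hdlo, hdhi⟩ := hd
  obtain ⟨hnlo, hnhi⟩ := hn
  have hdpos : 0 < fsD Δ tpd c ε := lt_of_lt_of_le hd₁ hdlo
  have hnpos : 0 < fsN tpd tpp c ε := lt_of_lt_of_le hn₁ hnlo
  rw [fsRatio_eq]
  constructor
  · calc -n₂ / (d₁ + 2 * n₂) ≤ -fsN tpd tpp c ε / (d₁ + 2 * fsN tpd tpp c ε) :=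
          neg_div_add_anti_n hd₁ hnpos hnhi
      _ ≤ -fsN tpd tpp c ε / (fsD Δ tpd c ε + 2 * fsN tpd tpp c ε) :=
          neg_div_add_mono_d hd₁ hdlo hnpos
  · calc -fsN tpd tpp c ε / (fsD Δ tpd c ε + 2 * fsN tpd tpp c ε)
          ≤ -fsN tpd tpp c ε / (d₂ + 2 * fsN tpd tpp c ε) := neg_div_add_mono_d hdpos hdhi hnpos
      _ ≤ -n₁ / (d₂ + 2 * n₁) := neg_div_add_anti_n (by linarith) hn₁ hnlo

/-- Corner enclosure of the nearest-neighbour weight over a parameter box: `Δ ∈ [Δ₁, Δ₂]`,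
`0 ≤ a₁ ≤ t_pd ≤ a₂`, `0 ≤ c₁ ≤ t_pp′ ≤ c₂`, `0 ≤ ε₁ ≤ ε ≤ ε₂`, with `Δ₁ + ε₁ ≥ 0` and
`c₂ε₂ ≤ a₁²` ⇒ `(Δ₁ + ε₁)(a₁² − c₂ε₂) ≤ fsD ≤ (Δ₂ + ε₂)(a₂² − c₁ε₁)`. [folklore] -/
theorem fsD_mem_Icc {Δ₁ Δ₂ a₁ a₂ c₁ c₂ ε₁ ε₂ Δ tpd c ε : ℝ} (ha₁ : 0 ≤ a₁) (hc₁ : 0 ≤ c₁)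
    (hε₁ : 0 ≤ ε₁) (hΔε : 0 ≤ Δ₁ + ε₁) (hcap : c₂ * ε₂ ≤ a₁ ^ 2)
    (hΔ : Δ ∈ Set.Icc Δ₁ Δ₂) (ha : tpd ∈ Set.Icc a₁ a₂) (hc : c ∈ Set.Icc c₁ c₂)
    (hε : ε ∈ Set.Icc ε₁ ε₂) :
    fsD Δ tpd c ε ∈ Set.Icc ((Δ₁ + ε₁) * (a₁ ^ 2 - c₂ * ε₂)) ((Δ₂ + ε₂) * (a₂ ^ 2 - c₁ * ε₁)) := by
  obtain ⟨hΔlo, hΔhi⟩ := hΔ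
  obtain ⟨halo, hahi⟩ := ha
  obtain ⟨hclo, hchi⟩ := hc
  obtain ⟨hεlo, hεhi⟩ := hε
  have htpd : 0 ≤ tpd := le_trans ha₁ halo
  have hcc : 0 ≤ c := le_trans hc₁ hclo
  have hεε : 0 ≤ ε := le_trans hε₁ hεlo
  have hsq_lo : a₁ ^ 2 ≤ tpd ^ 2 := pow_le_pow_left₀ ha₁ halo 2
  have hsq_hi : tpd ^ 2 ≤ a₂ ^ 2 := pow_le_pow_left₀ htpd hahi 2
  have hce_hi : c * ε ≤ c₂ * ε₂ := mul_le_mul hchi hεhi hεε (le_trans hcc hchi)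
  have hce_lo : c₁ * ε₁ ≤ c * ε := mul_le_mul hclo hεlo hε₁ hcc
  unfold fsD
  constructor
  · have h1 : 0 ≤ a₁ ^ 2 - c₂ * ε₂ := by linarith
    have h2 : a₁ ^ 2 - c₂ * ε₂ ≤ tpd ^ 2 - c * ε := by linarith
    have h3 : Δ₁ + ε₁ ≤ Δ + ε := by linarith
    calc (Δ₁ + ε₁) * (a₁ ^ 2 - c₂ * ε₂) ≤ (Δ + ε) * (a₁ ^ 2 - c₂ * ε₂) :=
          mul_le_mul_of_nonneg_right h3 h1
      _ ≤ (Δ + ε) * (tpd ^ 2 - c * ε) := mul_le_mul_of_nonneg_left h2 (le_trans hΔε h3)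
  · have h2 : tpd ^ 2 - c * ε ≤ a₂ ^ 2 - c₁ * ε₁ := by linarith
    have h3 : Δ + ε ≤ Δ₂ + ε₂ := by linarith
    have h0 : 0 ≤ Δ + ε := le_trans hΔε (by linarith)
    have h1 : 0 ≤ tpd ^ 2 - c * ε := by nlinarith
    calc (Δ + ε) * (tpd ^ 2 - c * ε) ≤ (Δ₂ + ε₂) * (tpd ^ 2 - c * ε) :=
          mul_le_mul_of_nonneg_right h3 h1
      _ ≤ (Δ₂ + ε₂) * (a₂ ^ 2 - c₁ * ε₁) := mul_le_mul_of_nonneg_left h2 (le_trans h0 h3)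

/-- `fsN` rewritten: `fsN = (t_pp′ + t_pp)(2t_pd² + ε(t_pp − t_pp′))`. [folklore] -/
theorem fsN_eq_mul (tpd tpp c ε : ℝ) :
    fsN tpd tpp c ε = (c + tpp) * (2 * tpd ^ 2 + ε * (tpp - c)) := by
  unfold fsN
  ring

/-- Corner enclosure of the diagonal weight over a parameter box: `0 ≤ a₁ ≤ t_pd ≤ a₂`,
`0 ≤ b₁ ≤ t_pp ≤ b₂`, `0 ≤ c₁ ≤ t_pp′ ≤ c₂`, `0 ≤ ε₁ ≤ ε ≤ ε₂` with `c₂ε₂ ≤ a₁²` (so the factor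
`2t_pd² + ε(t_pp − t_pp′)` is non-negative and monotone) ⇒
`(c₁ + b₁)(2a₁² + min(ε₁(b₁ − c₂), ε₂(b₁ − c₂))) ≤ fsN ≤ (c₂ + b₂)(2a₂² + max(ε₁(b₂ − c₁), ε₂(b₂ − c₁)))`.
[folklore] -/
theorem fsN_mem_Icc {a₁ a₂ b₁ b₂ c₁ c₂ ε₁ ε₂ tpd tpp c ε : ℝ} (ha₁ : 0 ≤ a₁) (hb₁ : 0 ≤ b₁)
    (hc₁ : 0 ≤ c₁) (hε₁ : 0 ≤ ε₁) (hcap : c₂ * ε₂ ≤ a₁ ^ 2)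
    (ha : tpd ∈ Set.Icc a₁ a₂) (hb : tpp ∈ Set.Icc b₁ b₂) (hc : c ∈ Set.Icc c₁ c₂)
    (hε : ε ∈ Set.Icc ε₁ ε₂) :
    fsN tpd tpp c ε ∈ Set.Icc
      ((c₁ + b₁) * (2 * a₁ ^ 2 + min (ε₁ * (b₁ - c₂)) (ε₂ * (b₁ - c₂))))
      ((c₂ + b₂) * (2 * a₂ ^ 2 + max (ε₁ * (b₂ - c₁)) (ε₂ * (b₂ - c₁)))) := by
  obtain ⟨halo, hahi⟩ := ha
  obtain ⟨hblo, hbhi⟩ := hb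
  obtain ⟨hclo, hchi⟩ := hc
  obtain ⟨hεlo, hεhi⟩ := hε
  have htpd : 0 ≤ tpd := le_trans ha₁ halo
  have hcc : 0 ≤ c := le_trans hc₁ hclo
  have hεε : 0 ≤ ε := le_trans hε₁ hεlo
  have hsq_lo : a₁ ^ 2 ≤ tpd ^ 2 := pow_le_pow_left₀ ha₁ halo 2
  have hsq_hi : tpd ^ 2 ≤ a₂ ^ 2 := pow_le_pow_left₀ htpd hahi 2
  have hce : c * ε ≤ c₂ * ε₂ := mul_le_mul hchi hεhi hεε (le_trans hcc hchi)
  -- the second factor is non-negative: 2t_pd² + ε(t_pp − c) ≥ 2a₁² − c₂ε₂ + … ≥ 0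
  have hfac : 0 ≤ 2 * tpd ^ 2 + ε * (tpp - c) := by
    have : 0 ≤ ε * tpp := mul_nonneg hεε (le_trans hb₁ hblo)
    nlinarith
  -- affine-in-ε bounds for ε·(tpp − c)
  have hlo_aff : min (ε₁ * (b₁ - c₂)) (ε₂ * (b₁ - c₂)) ≤ ε * (b₁ - c₂) := by
    rcases le_or_gt 0 (b₁ - c₂) with hs | hs
    · exact le_trans (min_le_left _ _) (mul_le_mul_of_nonneg_right hεlo hs)
    · exact le_trans (min_le_right _ _) (mul_le_mul_of_nonpos_right hεhi hs.le)
  have hhi_aff : ε * (b₂ - c₁) ≤ max (ε₁ * (b₂ - c₁)) (ε₂ * (b₂ - c₁)) := by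
    rcases le_or_gt 0 (b₂ - c₁) with hs | hs
    · exact le_trans (mul_le_mul_of_nonneg_right hεhi hs) (le_max_right _ _)
    · exact le_trans (mul_le_mul_of_nonpos_right hεlo hs.le) (le_max_left _ _)
  have hmid_lo : ε * (b₁ - c₂) ≤ ε * (tpp - c) := mul_le_mul_of_nonneg_left (by linarith) hεε
  have hmid_hi : ε * (tpp - c) ≤ ε * (b₂ - c₁) := mul_le_mul_of_nonneg_left (by linarith) hεε
  rw [fsN_eq_mul]
  constructor
  · have h1 : 0 ≤ c₁ + b₁ := by linarith
    have h2 : c₁ + b₁ ≤ c + tpp := by linarith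
    have h3 : 2 * a₁ ^ 2 + min (ε₁ * (b₁ - c₂)) (ε₂ * (b₁ - c₂)) ≤ 2 * tpd ^ 2 + ε * (tpp - c) := by
      linarith
    rcases le_or_gt 0 (2 * a₁ ^ 2 + min (ε₁ * (b₁ - c₂)) (ε₂ * (b₁ - c₂))) with hs | hs
    · calc (c₁ + b₁) * (2 * a₁ ^ 2 + min (ε₁ * (b₁ - c₂)) (ε₂ * (b₁ - c₂)))
            ≤ (c + tpp) * (2 * a₁ ^ 2 + min (ε₁ * (b₁ - c₂)) (ε₂ * (b₁ - c₂))) :=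
            mul_le_mul_of_nonneg_right h2 hs
        _ ≤ (c + tpp) * (2 * tpd ^ 2 + ε * (tpp - c)) :=
            mul_le_mul_of_nonneg_left h3 (le_trans h1 h2)
    · calc (c₁ + b₁) * (2 * a₁ ^ 2 + min (ε₁ * (b₁ - c₂)) (ε₂ * (b₁ - c₂))) ≤ 0 :=
            mul_nonpos_of_nonneg_of_nonpos h1 hs.le
        _ ≤ (c + tpp) * (2 * tpd ^ 2 + ε * (tpp - c)) := mul_nonneg (le_trans h1 h2) hfac
  · have h2 : c + tpp ≤ c₂ + b₂ := by linarith
    have h3 : 2 * tpd ^ 2 + ε * (tpp - c) ≤ 2 * a₂ ^ 2 + max (ε₁ * (b₂ - c₁)) (ε₂ * (b₂ - c₁)) := by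
      linarith
    calc (c + tpp) * (2 * tpd ^ 2 + ε * (tpp - c)) ≤ (c₂ + b₂) * (2 * tpd ^ 2 + ε * (tpp - c)) :=
          mul_le_mul_of_nonneg_right h2 hfac
      _ ≤ (c₂ + b₂) * (2 * a₂ ^ 2 + max (ε₁ * (b₂ - c₁)) (ε₂ * (b₂ - c₁))) :=
          mul_le_mul_of_nonneg_left h3 (by linarith [le_trans hcc hchi, le_trans hb₁ hblo])


/-! ## §2 The SCALE of the near-Fermi-surface `t–t′` model: the energy derivative of the secular function is
affine along every contour, so the first-order hopping scale is bracketed by its nodal and antinodal values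
(append 2026-08-27, hubbard-downfold-mod-4; §1 above byte-stable) -/

/-- Energy derivative of the k-independent coefficient: `cA′(ε) = (Δ + ε)(Δ + 3ε)`. [folklore] -/
def dcA (Δ ε : ℝ) : ℝ := (Δ + ε) * (Δ + 3 * ε)

/-- Energy derivative of the nearest-neighbour weight: `fsD′(ε) = t_pd² − t_pp′(Δ + 2ε)`. [folklore] -/
def dfsD (Δ tpd c ε : ℝ) : ℝ := tpd ^ 2 - c * (Δ + 2 * ε)

/-- Energy derivative of the diagonal weight: `fsN′ = t_pp² − t_pp′²` (energy independent). [folklore] -/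
def dfsN (tpp c : ℝ) : ℝ := tpp ^ 2 - c ^ 2

/-- The energy derivative of the secular cubic, `∂_ε charCubic = cA′ − 4fsD′(x + y) − 16fsN′·xy` — bilinear
in `(x, y)` like `charCubic` itself. [folklore] -/
def dcharCubic (Δ tpd tpp c x y ε : ℝ) : ℝ :=
  dcA Δ ε - 4 * dfsD Δ tpd c ε * (x + y) - 16 * dfsN tpp c * (x * y)

/-- EXACT TAYLOR IDENTITY in the energy: `charCubic(ε + h) = charCubic(ε) + h·∂_ε charCubic(ε)
+ h²·(3ε + 2Δ + 4t_pp′(x + y)) + h³` — so `dcharCubic` IS the first-order coefficient (no analysis needed).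
[folklore] -/
theorem charCubic_taylor (Δ tpd tpp c x y ε h : ℝ) :
    charCubic Δ tpd tpp c x y (ε + h) =
      charCubic Δ tpd tpp c x y ε + h * dcharCubic Δ tpd tpp c x y ε
        + h ^ 2 * (3 * ε + 2 * Δ + 4 * c * (x + y)) + h ^ 3 := by
  unfold charCubic dcharCubic dcA dfsD dfsN
  ring

/-- ON A CONTOUR the energy derivative is an AFFINE function of `s = x + y` alone: if
`charCubic(x, y, ε) = 0` and `fsN(ε) ≠ 0` then
`∂_ε charCubic = (cA′ − fsN′·cA/fsN) + (−4fsD′ + 4fsD·fsN′/fsN)·(x + y)` (eliminate `xy` by the contour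
equation `16fsN·xy = cA − 4fsD(x + y)`). [folklore] -/
theorem dcharCubic_on_contour (Δ tpd tpp c x y ε : ℝ) (hN : fsN tpd tpp c ε ≠ 0)
    (hP : charCubic Δ tpd tpp c x y ε = 0) :
    dcharCubic Δ tpd tpp c x y ε =
      (dcA Δ ε - dfsN tpp c * cA Δ ε / fsN tpd tpp c ε)
        + (-4 * dfsD Δ tpd c ε + 4 * fsD Δ tpd c ε * dfsN tpp c / fsN tpd tpp c ε) * (x + y) := by
  rw [charCubic_bilinear] at hP
  have hxy : x * y = (cA Δ ε - 4 * fsD Δ tpd c ε * (x + y)) / (16 * fsN tpd tpp c ε) := by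
    rw [eq_div_iff (mul_ne_zero (by norm_num) hN)]
    linarith
  unfold dcharCubic
  rw [hxy]
  field_simp
  ring

/-- The FIRST-ORDER HOPPING SCALE of the near-contour one-band model at a contour point `k`:
linearising `charCubic(k, ε) = 0` about `ε₀` gives `ε(k) − ε₀ ≈ −charCubic(k, ε₀)/∂_ε charCubic(k, ε₀)`,
i.e. the `t–t′` form of `EmeryFermiSurfaceShape.charCubic_eq_oneBandXY` divided by the local energy
denominator; its nearest-neighbour hopping is `fsT(ε₀)/∂_ε charCubic(k, ε₀)` (shape `fsT = fsD + 2fsN`,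
scale `1/∂_ε charCubic`). [cite: AndersenEtAl1995, §6 (energy-linearised downfolding, `ḋ`)] -/
def scaleT (Δ tpd tpp c x y ε : ℝ) : ℝ := fsT Δ tpd tpp c ε / dcharCubic Δ tpd tpp c x y ε

/-- An affine function on an interval takes its values between its endpoint values. [folklore] -/
theorem affine_mem_uIcc (A B s s₁ s₂ : ℝ) (hs : s ∈ Set.uIcc s₁ s₂) :
    A + B * s ∈ Set.uIcc (A + B * s₁) (A + B * s₂) := by
  rcases le_total 0 B with hB | hB
  · rcases Set.mem_uIcc.mp hs with ⟨h1, h2⟩ | ⟨h1, h2⟩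
    · exact Set.mem_uIcc.mpr (Or.inl ⟨by nlinarith, by nlinarith⟩)
    · exact Set.mem_uIcc.mpr (Or.inr ⟨by nlinarith, by nlinarith⟩)
  · rcases Set.mem_uIcc.mp hs with ⟨h1, h2⟩ | ⟨h1, h2⟩
    · exact Set.mem_uIcc.mpr (Or.inr ⟨by nlinarith, by nlinarith⟩)
    · exact Set.mem_uIcc.mpr (Or.inl ⟨by nlinarith, by nlinarith⟩)

/-- THE SCALE BRACKET: on one contour (energy `ε`), the energy denominator `∂_ε charCubic` at any contour
point with `x + y` between the values `s₁, s₂` of two reference contour points (e.g. the nodal and the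
antinodal Fermi points) lies between its values there — so the first-order scale `scaleT` of the whole
Fermi surface is bracketed by two closed-form numbers. [folklore] -/
theorem dcharCubic_mem_uIcc_on_contour (Δ tpd tpp c ε x y x₁ y₁ x₂ y₂ : ℝ) (hN : fsN tpd tpp c ε ≠ 0)
    (hP : charCubic Δ tpd tpp c x y ε = 0) (hP₁ : charCubic Δ tpd tpp c x₁ y₁ ε = 0)
    (hP₂ : charCubic Δ tpd tpp c x₂ y₂ ε = 0) (hs : x + y ∈ Set.uIcc (x₁ + y₁) (x₂ + y₂)) :
    dcharCubic Δ tpd tpp c x y ε ∈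
      Set.uIcc (dcharCubic Δ tpd tpp c x₁ y₁ ε) (dcharCubic Δ tpd tpp c x₂ y₂ ε) := by
  rw [dcharCubic_on_contour Δ tpd tpp c x y ε hN hP, dcharCubic_on_contour Δ tpd tpp c x₁ y₁ ε hN hP₁,
    dcharCubic_on_contour Δ tpd tpp c x₂ y₂ ε hN hP₂]
  exact affine_mem_uIcc _ _ _ _ _ hs

end Summit.Ventures.CertifiedManyBodySolver.Downfold.Emery
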